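import Literature.Analysis.UnboundedOperators.LinearizedBoltzmannBoundedImage
import HarnessLib

/-!
# The `L²(M dv)`-orthogonal inverse of the linearised hard-sphere operator is NOT sup-norm bounded

For the linearised hard-sphere collision operator `L` of `ℝ³` around the normalised Maxwellian `M`
(`Literature.Analysis.UnboundedOperators.hardSphereLinearizedOp`, `M dv = stdGaussian`; CIP 1994 §7.2)
and a bounded `g` which is `M`-orthogonal to the collision invariants `span {1, v, |v|²}`, the equation
`L ψ = g` has a unique solution `ψ ∈ L²(M dv)` which is `M`-orthogonal to the invariants (Fredholm
alternative + spectral gap; in the tree with Gaussian growth and continuity,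
`exists_continuous_inverse_hardSphereLinearizedOp`). Grad's weighted sup-norm theory
(Grad 1963, Caflisch 1980, Guo 2010) bounds this `ψ` in the weights `e^{θ|v|²}`, `θ < 1/4`
(in the `M^{1/2}`-picture), i.e. strictly above the borderline at which `ψ` itself would be bounded.

**Main result** (`exists_unbounded_orthogonal_inverse_hardSphereLinearizedOp`): the borderline
statement is FALSE — there is an explicit bounded continuous `g ⊥_M span {1, v, |v|²}` whose
`M`-orthogonal pre-image `ψ` (continuous, of linear growth, in `L²(M dv)`) is unbounded. Construction:
`ψ̃ = τ(· - v₀) - τ(· + v₀)` (`τ` the unit tent, `|v₀| = 2`) is odd, bounded, compactly supported and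
has non-zero momentum `m = ∫ ψ̃ w dM(w)`; `g := L ψ̃` is bounded and continuous
(`LinearizedBoltzmannBoundedImage`), and the orthogonal solution is `ψ = ψ̃ - ⟪m, ·⟫`, which grows
linearly along `m`. In words: the bounded solutions of `L ψ = g` (here `ψ̃ + const`) are in general NOT
orthogonal to the momentum (and energy) invariants, and the orthogonal one picks up a non-trivial
element of `span {v, |v|²}`.

Corollaries: the literal negations `not_supNorm_orthogonal_inverse_hardSphereLinearizedOp` (of
`∃ C₁, ∀ ψ g b, |g| ≤ b → ψ ∈ L²(M) → ψ ⊥ invariants → L ψ = g → |ψ| ≤ C₁ b`) and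
`not_supNorm_orthogonal_inverse_hardSphereLinearizedOp_of_gaussGrowth` (the same with continuity and
the a-priori Gaussian growth `|ψ| ≤ C₀ b e^{|v|²/4}` added). What is NOT here: any positive sup-norm
statement (whether every bounded `g ⊥` invariants has SOME bounded pre-image is a different, finer
question: it asks for the exact asymptotics `ψ = c(|v|² - 3) + ⟪e, v⟫ + O(1)` of the orthogonal
solution). No new definitions are introduced.
-/

open MeasureTheory Metric Real Set Filter Topology ProbabilityTheory Module
open scoped InnerProductSpace ENNReal

namespace Literature.Analysis.UnboundedOperators

noncomputable section

open Literature.MathematicalPhysics.KineticTheory (collide sphereMeasure hardSphereKernel)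
open Literature.Analysis.FluidPDE

section Example

/-- **Tent profile facts**: `τ(x) = max (1 - |x|) 0` is continuous, takes values in `[0, 1]`, is even
and vanishes off the open unit ball. [folklore] -/
theorem continuous_unitTent_and_bounds :
    Continuous (fun x : EuclideanSpace ℝ (Fin 3) => max (1 - ‖x‖) 0) ∧
      (∀ x : EuclideanSpace ℝ (Fin 3), 0 ≤ max (1 - ‖x‖) 0 ∧ max (1 - ‖x‖) 0 ≤ 1) ∧
      (∀ x : EuclideanSpace ℝ (Fin 3), 1 ≤ ‖x‖ → max (1 - ‖x‖) 0 = 0) ∧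
      ∀ x : EuclideanSpace ℝ (Fin 3), max (1 - ‖-x‖) 0 = max (1 - ‖x‖) 0 := by
  refine ⟨by fun_prop, fun x => ⟨le_max_right _ _, max_le (by linarith [norm_nonneg x]) zero_le_one⟩,
    fun x hx => max_eq_right (by linarith), fun x => by rw [norm_neg]⟩

/-- **An explicit bounded `g ⊥` collision invariants whose `L²(M dv)`-orthogonal pre-image under the
linearised hard-sphere operator of `ℝ³` is unbounded.** Take the odd, compactly supported, continuous
`ψ̃(v) = τ(v - v₀) - τ(v + v₀)` (`τ` the unit tent, `|v₀| = 2`) and its momentum `m = ∫ ψ̃(w) w dM(w) ≠ 0`;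
then `ψ = ψ̃ - ⟪m, ·⟫` is continuous, of linear (a fortiori Gaussian) growth, in `L²(M dv)`,
`M`-orthogonal to `span {1, v, |v|²}`, and `L ψ = L ψ̃ =: g` everywhere, with `g` bounded and continuous
— yet `|ψ(t m)| → ∞`. Hence the `M`-orthogonal solution of `L ψ = g` (unique by the spectral gap) is in
general NOT bounded for bounded `g`: the bounded solutions of `L ψ = g` are `ψ̃ + const`, which are not
orthogonal to the momentum invariants. (Grad's weighted sup-norm theory of `L⁻¹`, Grad 1963 /
Caflisch 1980 / Guo 2010, stops at weights `e^{θ|v|²}`, `θ < 1/4`, in the `M^{1/2}`-picture; at the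
borderline weight the sup-norm bound of the orthogonal inverse fails.) [folklore] -/
theorem exists_unbounded_orthogonal_inverse_hardSphereLinearizedOp :
    ∃ (ψ g : EuclideanSpace ℝ (Fin 3) → ℝ) (b : ℝ), Continuous ψ ∧ Continuous g ∧ (∀ v, |g v| ≤ b) ∧
      (∃ C : ℝ, ∀ v, |ψ v| ≤ C * Real.exp (‖v‖ ^ 2 / 4)) ∧
      MemLp ψ 2 (stdGaussian (EuclideanSpace ℝ (Fin 3))) ∧
      (∀ φ ∈ collisionInvariants (EuclideanSpace ℝ (Fin 3)), maxwellianInner ψ φ = 0) ∧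
      (∀ v, hardSphereLinearizedOp ψ v = g v) ∧ ∀ C : ℝ, ∃ v, C < |ψ v| := by
  obtain ⟨hτc, hτ01, hτ0, hτev⟩ := continuous_unitTent_and_bounds
  -- a unit vector and the centre `v₀ = 2 e₀`
  obtain ⟨e₀, he₀⟩ : ∃ e : EuclideanSpace ℝ (Fin 3), ‖e‖ = 1 := exists_norm_eq _ zero_le_one
  set v₀ : EuclideanSpace ℝ (Fin 3) := (2 : ℝ) • e₀ with hv₀
  have hv₀n : ‖v₀‖ = 2 := by rw [hv₀, norm_smul, he₀, mul_one, Real.norm_eq_abs, abs_of_pos two_pos]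
  have he₀v₀ : ⟪e₀, v₀⟫_ℝ = 2 := by
    rw [hv₀, real_inner_smul_right, real_inner_self_eq_norm_sq, he₀]; norm_num
  -- the odd tent difference `ψ̃`
  set ψt : EuclideanSpace ℝ (Fin 3) → ℝ := fun v => max (1 - ‖v - v₀‖) 0 - max (1 - ‖v + v₀‖) 0 with hψt
  have hψtc : Continuous ψt := by rw [hψt]; fun_prop
  have hψtm : Measurable ψt := hψtc.measurable
  have hψt1 : ∀ v, |ψt v| ≤ 1 := fun v => by
    rw [hψt, abs_le]
    obtain ⟨a0, a1⟩ := hτ01 (v - v₀)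
    obtain ⟨b0, b1⟩ := hτ01 (v + v₀)
    constructor <;> linarith
  have hψtR : ∀ v : EuclideanSpace ℝ (Fin 3), 3 < ‖v‖ → ψt v = 0 := by
    intro v hv
    have h1 : 1 ≤ ‖v - v₀‖ := by
      have := norm_sub_norm_le v v₀; rw [hv₀n] at this; linarith
    have h2 : 1 ≤ ‖v + v₀‖ := by
      have h' : ‖v‖ ≤ ‖v + v₀‖ + ‖v₀‖ := by
        have := norm_add_le (v + v₀) (-v₀); simp only [add_neg_cancel_right, norm_neg] at this; exact this
      rw [hv₀n] at h'; linarith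
    simp only [hψt, hτ0 _ h1, hτ0 _ h2, sub_zero]
  have hψtodd : ∀ v, ψt (-v) = -ψt v := fun v => by
    simp only [hψt]
    rw [show -v - v₀ = -(v + v₀) by abel, show -v + v₀ = -(v - v₀) by abel, hτev, hτev]
    ring
  have hψt_exp : ∀ v, |ψt v| ≤ 1 * Real.exp (‖v‖ ^ 2 / 4) := fun v =>
    (hψt1 v).trans (by rw [one_mul]; exact Real.one_le_exp (by positivity))
  have hmean : ∫ w, ψt w ∂stdGaussian (EuclideanSpace ℝ (Fin 3)) = 0 :=
    integral_stdGaussian_eq_zero_of_odd (LinearIsometryEquiv.neg ℝ) fun v => by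
      simpa using hψtodd v
  -- the momentum `m = ∫ ψ̃(w) w dM(w)`
  have hnorm : Integrable (fun w : EuclideanSpace ℝ (Fin 3) => ‖w‖) (stdGaussian (EuclideanSpace ℝ (Fin 3))) := by
    simpa using (IsGaussian.memLp_id (stdGaussian (EuclideanSpace ℝ (Fin 3))) 1
      ENNReal.one_ne_top).integrable le_rfl |>.norm
  have hsmul : Integrable (fun w => ψt w • w) (stdGaussian (EuclideanSpace ℝ (Fin 3))) := by
    refine hnorm.mono' (hψtm.aestronglyMeasurable.smul aestronglyMeasurable_id) (Eventually.of_forall fun w => ?_)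
    rw [norm_smul, Real.norm_eq_abs]
    exact mul_le_of_le_one_left (norm_nonneg _) (hψt1 w)
  set m : EuclideanSpace ℝ (Fin 3) := ∫ w, ψt w • w ∂stdGaussian (EuclideanSpace ℝ (Fin 3)) with hm
  have hm_inner : ∀ c : EuclideanSpace ℝ (Fin 3),
      ∫ w, ψt w * ⟪c, w⟫_ℝ ∂stdGaussian (EuclideanSpace ℝ (Fin 3)) = ⟪c, m⟫_ℝ := by
    intro c
    rw [hm, ← integral_inner hsmul c]
    refine integral_congr_ae (Eventually.of_forall fun w => ?_)
    simp only [real_inner_smul_right]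
  -- the solution `ψ = ψ̃ - ⟪m, ·⟫` and the datum `g = L ψ̃`
  set ψ : EuclideanSpace ℝ (Fin 3) → ℝ := fun v => ψt v - ⟪m, v⟫_ℝ with hψ
  obtain ⟨b, hb⟩ := exists_abs_hardSphereLinearizedOp_le_of_bounded_support hψtm hψt1 (by norm_num : (0 : ℝ) ≤ 3)
    hψtR hmean
  refine ⟨ψ, hardSphereLinearizedOp ψt, b, ?_, ?_, hb, ⟨1 + ‖m‖, fun v => ?_⟩, ?_, ?_, fun v => ?_, fun C => ?_⟩
  · -- continuity of `ψ`
    rw [hψ]; fun_prop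
  · -- continuity of `g = K ψ̃ - ν ψ̃`
    obtain ⟨-, hνc⟩ := collisionFrequency_pos_and_continuous (E := EuclideanSpace ℝ (Fin 3)) (by simp)
    have hfun : hardSphereLinearizedOp ψt = fun v => (∫ w, ∫ ω, hardSphereKernel (v, w) ω *
        (ψt (collide ω (v, w)).1 + ψt (collide ω (v, w)).2 - ψt w) ∂sphereMeasure
          ∂stdGaussian (EuclideanSpace ℝ (Fin 3))) - collisionFrequency v * ψt v :=
      funext fun v => hardSphereLinearizedOp_eq_kernel_sub_of_gaussGrowth hψtm hψt_exp v
    rw [hfun]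
    exact (continuous_kernelAction_of_gaussGrowth hψtm hψt_exp).sub (hνc.mul hψtc)
  · -- Gaussian (indeed linear) growth
    calc |ψ v| ≤ |ψt v| + |⟪m, v⟫_ℝ| := abs_sub _ _
      _ ≤ 1 * Real.exp (‖v‖ ^ 2 / 4) + ‖m‖ * Real.exp (‖v‖ ^ 2 / 4) :=
          add_le_add (hψt_exp v) (abs_inner_le_norm_mul_exp m v)
      _ = (1 + ‖m‖) * Real.exp (‖v‖ ^ 2 / 4) := by ring
  · -- `ψ ∈ L²(M dv)`
    refine memLp_two_of_abs_le_pow (by rw [hψ]; fun_prop : Continuous ψ).aestronglyMeasurable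
      (C := 1 + ‖m‖) (m := 1) fun v => ?_
    rw [pow_one]
    calc |ψ v| ≤ |ψt v| + |⟪m, v⟫_ℝ| := abs_sub _ _
      _ ≤ 1 + ‖m‖ * ‖v‖ := add_le_add (hψt1 v) (abs_real_inner_le_norm m v)
      _ ≤ (1 + ‖m‖) * (1 + ‖v‖) := by nlinarith [norm_nonneg m, norm_nonneg v]
  · -- orthogonality to the collision invariants
    intro φ hφ
    obtain ⟨a, c, bb, rfl⟩ := mem_collisionInvariants_iff.1 hφ
    have hψodd : ∀ v, ψ (-v) = -ψ v := fun v => by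
      simp only [hψ, hψtodd, inner_neg_right]; ring
    have hψb : ∀ v, |ψ v| ≤ (1 + ‖m‖) * (1 + ‖v‖) := fun v => by
      calc |ψ v| ≤ |ψt v| + |⟪m, v⟫_ℝ| := abs_sub _ _
        _ ≤ 1 + ‖m‖ * ‖v‖ := add_le_add (hψt1 v) (abs_real_inner_le_norm m v)
        _ ≤ (1 + ‖m‖) * (1 + ‖v‖) := by nlinarith [norm_nonneg m, norm_nonneg v]
    have hψc : Continuous ψ := by rw [hψ]; fun_prop
    -- the even-weight part is odd, hence has zero integral; the linear part is computed
    have hI1 : Integrable (fun v => ψ v * (a + c * ‖v‖ ^ 2)) (stdGaussian (EuclideanSpace ℝ (Fin 3))) := by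
      refine ((integrable_one_add_norm_pow_stdGaussian 3).const_mul ((1 + ‖m‖) * (|a| + |c|))).mono'
        (by fun_prop : Continuous fun v => ψ v * (a + c * ‖v‖ ^ 2)).aestronglyMeasurable
        (Eventually.of_forall fun v => ?_)
      rw [Real.norm_eq_abs, abs_mul]
      have h2 : |a + c * ‖v‖ ^ 2| ≤ (|a| + |c|) * (1 + ‖v‖) ^ 2 := by
        calc |a + c * ‖v‖ ^ 2| ≤ |a| + |c| * ‖v‖ ^ 2 := by
              have h := abs_add_le a (c * ‖v‖ ^ 2)
              rwa [abs_mul, abs_of_nonneg (sq_nonneg ‖v‖)] at h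
          _ ≤ (|a| + |c|) * (1 + ‖v‖) ^ 2 := by
              nlinarith [abs_nonneg a, abs_nonneg c, norm_nonneg v, mul_nonneg (abs_nonneg c) (norm_nonneg v)]
      calc |ψ v| * |a + c * ‖v‖ ^ 2| ≤ ((1 + ‖m‖) * (1 + ‖v‖)) * ((|a| + |c|) * (1 + ‖v‖) ^ 2) :=
            mul_le_mul (hψb v) h2 (abs_nonneg _) (by positivity)
        _ = (1 + ‖m‖) * (|a| + |c|) * (1 + ‖v‖) ^ 3 := by ring
    have hI2 : Integrable (fun v => ψ v * ⟪bb, v⟫_ℝ) (stdGaussian (EuclideanSpace ℝ (Fin 3))) := by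
      refine ((integrable_one_add_norm_pow_stdGaussian 2).const_mul ((1 + ‖m‖) * ‖bb‖)).mono'
        (by fun_prop : Continuous fun v => ψ v * ⟪bb, v⟫_ℝ).aestronglyMeasurable
        (Eventually.of_forall fun v => ?_)
      rw [Real.norm_eq_abs, abs_mul]
      calc |ψ v| * |⟪bb, v⟫_ℝ| ≤ ((1 + ‖m‖) * (1 + ‖v‖)) * (‖bb‖ * ‖v‖) :=
            mul_le_mul (hψb v) (abs_real_inner_le_norm bb v) (abs_nonneg _) (by positivity)
        _ ≤ (1 + ‖m‖) * ‖bb‖ * (1 + ‖v‖) ^ 2 := by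
            nlinarith [norm_nonneg m, norm_nonneg v, norm_nonneg bb,
              mul_nonneg (mul_nonneg (by positivity : (0 : ℝ) ≤ 1 + ‖m‖) (norm_nonneg bb)) (norm_nonneg v)]
    have hodd0 : ∫ v, ψ v * (a + c * ‖v‖ ^ 2) ∂stdGaussian (EuclideanSpace ℝ (Fin 3)) = 0 :=
      integral_stdGaussian_eq_zero_of_odd (LinearIsometryEquiv.neg ℝ) fun v => by
        simp only [LinearIsometryEquiv.coe_neg, hψodd, norm_neg]
        ring
    have hlin : ∫ v, ψ v * ⟪bb, v⟫_ℝ ∂stdGaussian (EuclideanSpace ℝ (Fin 3)) = 0 := by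
      have hI3 : Integrable (fun v => ψt v * ⟪bb, v⟫_ℝ) (stdGaussian (EuclideanSpace ℝ (Fin 3))) := by
        refine ((integrable_one_add_norm_pow_stdGaussian 1).const_mul ‖bb‖).mono'
          (by fun_prop : Continuous fun v => ψt v * ⟪bb, v⟫_ℝ).aestronglyMeasurable
          (Eventually.of_forall fun v => ?_)
        rw [Real.norm_eq_abs, abs_mul, pow_one]
        calc |ψt v| * |⟪bb, v⟫_ℝ| ≤ 1 * (‖bb‖ * ‖v‖) :=
              mul_le_mul (hψt1 v) (abs_real_inner_le_norm bb v) (abs_nonneg _) zero_le_one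
          _ ≤ ‖bb‖ * (1 + ‖v‖) := by nlinarith [norm_nonneg bb, norm_nonneg v]
      have hI4 : Integrable (fun v : EuclideanSpace ℝ (Fin 3) => ⟪m, v⟫_ℝ * ⟪bb, v⟫_ℝ)
          (stdGaussian (EuclideanSpace ℝ (Fin 3))) :=
        integrable_stdGaussian_of_hasTemperateGrowth (by fun_prop)
      have hsplit : (fun v => ψ v * ⟪bb, v⟫_ℝ) = fun v => ψt v * ⟪bb, v⟫_ℝ - ⟪m, v⟫_ℝ * ⟪bb, v⟫_ℝ := by
        funext v; simp only [hψ]; ring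
      rw [hsplit, integral_sub hI3 hI4, hm_inner bb,
        Literature.MathematicalPhysics.KineticTheory.integral_inner_mul_inner_stdGaussian m bb,
        real_inner_comm, sub_self]
    have hsplit : (fun v => ψ v * (a + ⟪bb, v⟫_ℝ + c * ‖v‖ ^ 2)) =
        fun v => ψ v * (a + c * ‖v‖ ^ 2) + ψ v * ⟪bb, v⟫_ℝ := by
      funext v; ring
    rw [maxwellianInner, hsplit, integral_add hI1 hI2, hodd0, hlin, add_zero]
  · -- `L ψ = L ψ̃ = g`
    exact hardSphereLinearizedOp_sub_inner hψtm hψt_exp m v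
  · -- unboundedness along `e₀`: `⟪m, e₀⟫ > 0`
    have hF0 : ∀ w, 0 ≤ ψt w * ⟪e₀, w⟫_ℝ := by
      intro w
      have hx1 : |⟪e₀, w⟫_ℝ - 2| ≤ ‖w - v₀‖ := by
        rw [← he₀v₀, ← inner_sub_right]
        simpa [he₀] using abs_real_inner_le_norm e₀ (w - v₀)
      have hx2 : |⟪e₀, w⟫_ℝ + 2| ≤ ‖w + v₀‖ := by
        rw [← he₀v₀, ← inner_add_right]
        simpa [he₀] using abs_real_inner_le_norm e₀ (w + v₀)
      simp only [hψt]
      rcases lt_or_ge ‖w - v₀‖ 1 with h1 | h1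
      · have hx : 1 < ⟪e₀, w⟫_ℝ := by rw [abs_le] at hx1; linarith
        have h2 : 1 ≤ ‖w + v₀‖ := by
          have : 3 < |⟪e₀, w⟫_ℝ + 2| := by rw [lt_abs]; left; linarith
          linarith
        rw [hτ0 _ h2, sub_zero]
        exact mul_nonneg (hτ01 _).1 (by linarith)
      · rw [hτ0 _ h1, zero_sub, neg_mul, neg_nonneg]
        rcases lt_or_ge ‖w + v₀‖ 1 with h2 | h2
        · have hx : ⟪e₀, w⟫_ℝ < -1 := by rw [abs_le] at hx2; linarith
          exact mul_nonpos_of_nonneg_of_nonpos (hτ01 _).1 (by linarith)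
        · rw [hτ0 _ h2, zero_mul]
    have hFi : Integrable (fun w => ψt w * ⟪e₀, w⟫_ℝ) (stdGaussian (EuclideanSpace ℝ (Fin 3))) := by
      refine ((integrable_one_add_norm_pow_stdGaussian 1).const_mul ‖e₀‖).mono'
        (by fun_prop : Continuous fun v => ψt v * ⟪e₀, v⟫_ℝ).aestronglyMeasurable
        (Eventually.of_forall fun v => ?_)
      rw [Real.norm_eq_abs, abs_mul, pow_one]
      calc |ψt v| * |⟪e₀, v⟫_ℝ| ≤ 1 * (‖e₀‖ * ‖v‖) :=
            mul_le_mul (hψt1 v) (abs_real_inner_le_norm e₀ v) (abs_nonneg _) zero_le_one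
        _ ≤ ‖e₀‖ * (1 + ‖v‖) := by nlinarith [norm_nonneg e₀, norm_nonneg v]
    have hsupp : ball v₀ (1 / 2) ⊆ Function.support fun w => ψt w * ⟪e₀, w⟫_ℝ := by
      intro w hw
      rw [mem_ball, dist_eq_norm] at hw
      have hx1 : |⟪e₀, w⟫_ℝ - 2| ≤ ‖w - v₀‖ := by
        rw [← he₀v₀, ← inner_sub_right]
        simpa [he₀] using abs_real_inner_le_norm e₀ (w - v₀)
      have hx : 3 / 2 < ⟪e₀, w⟫_ℝ := by rw [abs_le] at hx1; linarith
      have h2 : 1 ≤ ‖w + v₀‖ := by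
        have hx2 : |⟪e₀, w⟫_ℝ + 2| ≤ ‖w + v₀‖ := by
          rw [← he₀v₀, ← inner_add_right]
          simpa [he₀] using abs_real_inner_le_norm e₀ (w + v₀)
        have : 3 < |⟪e₀, w⟫_ℝ + 2| := by rw [lt_abs]; left; linarith
        linarith
      have hτpos : 1 / 2 < max (1 - ‖w - v₀‖) 0 := lt_max_of_lt_left (by linarith)
      rw [Function.mem_support]
      simp only [hψt, hτ0 _ h2, sub_zero]
      exact (mul_pos (by linarith) (by linarith)).ne'
    have hball : 0 < stdGaussian (EuclideanSpace ℝ (Fin 3)) (ball v₀ (1 / 2)) := by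
      have hM : Measurable fun v : EuclideanSpace ℝ (Fin 3) => ENNReal.ofReal (globalMaxwellian v) :=
        continuous_globalMaxwellian.measurable.ennreal_ofReal
      have hac : (volume : Measure (EuclideanSpace ℝ (Fin 3))) ≪ stdGaussian (EuclideanSpace ℝ (Fin 3)) := by
        rw [stdGaussian_eq_withDensity_globalMaxwellian_holds]
        exact withDensity_absolutelyContinuous' hM.aemeasurable
          (Eventually.of_forall fun v => (ENNReal.ofReal_pos.2 (globalMaxwellian_pos v)).ne')
      refine pos_iff_ne_zero.2 fun h0 => ?_
      have := hac h0
      exact (measure_ball_pos (volume : Measure (EuclideanSpace ℝ (Fin 3))) v₀ (by norm_num)).ne' this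
    have hκ : 0 < ⟪m, e₀⟫_ℝ := by
      rw [real_inner_comm, ← hm_inner e₀]
      exact (integral_pos_iff_support_of_nonneg hF0 hFi).2 (hball.trans_le (measure_mono hsupp))
    -- evaluate `ψ` at `t e₀`, `t = (|C| + 2)/⟪m, e₀⟫`
    set t : ℝ := (|C| + 2) / ⟪m, e₀⟫_ℝ with ht
    have htκ : t * ⟪m, e₀⟫_ℝ = |C| + 2 := by rw [ht]; field_simp
    refine ⟨t • e₀, ?_⟩
    have h1 : |⟪m, t • e₀⟫_ℝ| = |C| + 2 := by
      rw [real_inner_smul_right, htκ, abs_of_pos (by positivity)]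
    have h2 : |C| + 2 - 1 ≤ |ψ (t • e₀)| := by
      have := abs_sub_abs_le_abs_sub (⟪m, t • e₀⟫_ℝ) (ψt (t • e₀))
      rw [h1] at this
      have h3 : |⟪m, t • e₀⟫_ℝ - ψt (t • e₀)| = |ψ (t • e₀)| := by
        rw [hψ]; dsimp only; rw [← abs_neg]; ring_nf
      linarith [hψt1 (t • e₀), h3.symm.le, h3.le]
    linarith [le_abs_self C]

end Example

section Corollaries

/-- **The sup-norm estimate for the `M`-orthogonal inverse of the linearised hard-sphere operator is
false** (literal negation of the borderline-weight statement
`∃ C₁ > 0, ∀ ψ g b, |g| ≤ b → ψ ∈ L²(M) → ψ ⊥_M invariants → L ψ = g → |ψ| ≤ C₁ b` on `ℝ³`):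
by `exists_unbounded_orthogonal_inverse_hardSphereLinearizedOp`. [folklore] -/
theorem not_supNorm_orthogonal_inverse_hardSphereLinearizedOp :
    ¬ ∃ C₁ : ℝ, 0 < C₁ ∧ ∀ (ψ g : EuclideanSpace ℝ (Fin 3) → ℝ) (b : ℝ), (∀ v, |g v| ≤ b) →
      MemLp ψ 2 (stdGaussian (EuclideanSpace ℝ (Fin 3))) →
      (∀ φ ∈ collisionInvariants (EuclideanSpace ℝ (Fin 3)), maxwellianInner ψ φ = 0) →
      (∀ v, hardSphereLinearizedOp ψ v = g v) → ∀ v, |ψ v| ≤ C₁ * b := by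
  rintro ⟨C₁, -, h⟩
  obtain ⟨ψ, g, b, -, -, hgb, -, hmem, horth, hL, hunb⟩ :=
    exists_unbounded_orthogonal_inverse_hardSphereLinearizedOp
  obtain ⟨v, hv⟩ := hunb (C₁ * b)
  exact (not_lt.2 (h ψ g b hgb hmem horth hL v)) hv

/-- **… and it stays false under all the a-priori information of the Chapman–Enskog inverse**
(`exists_continuous_inverse_hardSphereLinearizedOp`): continuity of `ψ` and `g`, the Gaussian growth
`|ψ(v)| ≤ C₀ b e^{|v|²/4}`, `ψ ∈ L²(M dv)` and `ψ ⊥_M span {1, v, |v|²}` together do NOT give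
`‖ψ‖_∞ ≤ C₁ ‖g‖_∞`, whatever the constants `C₀, C₁` (enlarge `b` in the counterexample). The bounded
pre-images of a bounded `g ⊥` invariants, when they exist, differ from the orthogonal one by a
non-trivial element of `span {v, |v|²}`. [folklore] -/
theorem not_supNorm_orthogonal_inverse_hardSphereLinearizedOp_of_gaussGrowth :
    ¬ ∃ C₀ C₁ : ℝ, 0 < C₀ ∧ 0 < C₁ ∧ ∀ (ψ g : EuclideanSpace ℝ (Fin 3) → ℝ) (b : ℝ),
      Continuous ψ → Continuous g → (∀ v, |g v| ≤ b) →
      (∀ v, |ψ v| ≤ C₀ * b * Real.exp (‖v‖ ^ 2 / 4)) →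
      MemLp ψ 2 (stdGaussian (EuclideanSpace ℝ (Fin 3))) →
      (∀ φ ∈ collisionInvariants (EuclideanSpace ℝ (Fin 3)), maxwellianInner ψ φ = 0) →
      (∀ v, hardSphereLinearizedOp ψ v = g v) → ∀ v, |ψ v| ≤ C₁ * b := by
  rintro ⟨C₀, C₁, hC₀, -, h⟩
  obtain ⟨ψ, g, b, hψc, hgc, hgb, ⟨C, hC⟩, hmem, horth, hL, hunb⟩ :=
    exists_unbounded_orthogonal_inverse_hardSphereLinearizedOp
  set b' : ℝ := max b (C / C₀) with hb'
  have hgb' : ∀ v, |g v| ≤ b' := fun v => (hgb v).trans (le_max_left _ _)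
  have hCb' : C ≤ C₀ * b' := by
    calc C = C₀ * (C / C₀) := by field_simp
      _ ≤ C₀ * b' := mul_le_mul_of_nonneg_left (le_max_right _ _) hC₀.le
  have hgrowth : ∀ v, |ψ v| ≤ C₀ * b' * Real.exp (‖v‖ ^ 2 / 4) := fun v =>
    (hC v).trans (mul_le_mul_of_nonneg_right hCb' (Real.exp_nonneg _))
  obtain ⟨v, hv⟩ := hunb (C₁ * b')
  exact (not_lt.2 (h ψ g b' hψc hgc hgb' hgrowth hmem horth hL v)) hv

end Corollaries

end

end Literature.Analysis.UnboundedOperators
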